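import Summits.AtomisticToContinuum.FouriersLaw.Theses.VanishingNoiseTransfer
import Literature.MathematicalPhysics.KineticTheory.VelocityFlipNoise
import Summits.AtomisticToContinuum.FouriersLaw.Theorems.VanishingNoiseTransferNoiseLocalityStubFlipSteadyStateWellPosed
import Summits.AtomisticToContinuum.FouriersLaw.Theorems.VanishingNoiseTransferNoiseLocalityStubPositiveNoisyConductance
import Summits.AtomisticToContinuum.FouriersLaw.Theorems.VanishingNoiseTransferNoiseLocalityStubResponseContinuousInNoise
import Summits.AtomisticToContinuum.FouriersLaw.Theorems.VanishingNoiseTransferNoiseLocalityStubFlipDissipationBound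
import Summits.AtomisticToContinuum.FouriersLaw.Theorems.VanishingNoiseTransferNoiseLocalityFeketeReductionAux

/-!
# Line `polya-noise-monotone` for crux `VanishingNoiseTransfer.NoiseLocality`
(stmt-AtomisticToContinuum-11975, route `route-AtomisticToContinuum-VanishingNoiseTransfer`, rank 2) —
ALTERNATIVE line (crux-strategist s2, 2026-08-17); it does not touch the live line `fekete-transposed-uniformity` v7.

THE PÓLYA DUAL OF v7.  v7 makes the `N`-uniform modulus out of ORDER IN THE LENGTH (M1⋆: `r_N = 1/D_N`
quasi-nonincreasing in `N`, uniformly in the rate — Dini's mechanism) plus a fixed-`N` sign (M2⋆).  Here the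
order structure is put on the NOISE variable and nothing at all is compared across lengths: Pólya's theorem
("functions monotone in the variable that are pointwise close to a limit are uniformly close") replaces Dini's.
With `r_N(ε) := 1/D_N(ε)` along the unique flip-steady families (`ε ∈ [0,1]`; continuous on `[0,1]` and `> 0` at
every fixed `N ≥ 2` — LANDED stubs 1–3 of the fekete line), the crux follows from three registered stubs:

* S1 `stub_smallNoiseQuasiMonotone` — UPWARD EQUI-QUASI-MONOTONICITY IN THE NOISE, long chains, small rates,
  positive rates only: `∀ η > 0 ∃ N_η ε_η ∀ N ≥ N_η ∀ 0 < ε ≤ ε' ≤ ε_η : r_N(ε) ≤ r_N(ε') + η`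
  ("raising a small flip rate never LOWERS the resistivity of a long chain by a fixed amount").  NECESSARY for
  the crux (`|r_N(ε) − r_N(ε')| ≤ w(ε) + w(ε')`).  By fixed-`N` continuity it passes to `ε = 0⁺` and yields the
  LOWER half `r_N(0) ≤ r_N(ε') + η` (`closure_le`), i.e. v7's M2⋆ in its weakest (η-slack, eventual) form.
* S2 `stub_noResidualResistivity` — NO RESIDUAL RESISTIVITY, POINTWISE in the rate, EVENTUAL in the length:
  `∀ η > 0 ∃ ε_η ∀ ε ∈ (0, ε_η] ∃ N₀ ∀ N ≥ N₀ : r_N(ε) ≤ r_N(0) + η` (the threshold `N₀` MAY DEPEND ON `ε`: an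
  iterated-limit statement, `limsup_N`-first; in a world with limits it reads `liminf_{ε↓0} κ_ε ≥ κ_0`, the lower
  semicontinuity half of the vanishing-noise question of BernardinHuveneersLebowitzLiveraniOlla2015 §1).
  NECESSARY for the crux (take `N₀ = 0`).
* F `stub_noisyConductanceFloor` — at every FIXED positive rate the long noisy chains conduct:
  `∀ ε ∈ (0,1] ∃ d > 0 ∃ N₀ ∀ N ≥ N₀ : D_N(ε) ≥ d`.  PROVED below from the route's own rank-4 crux `NoisyFourier`
  (`noisyFloor_of_noisyFourier`), so it adds nothing to the route's cone; it is registered separately because it is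
  far weaker than `NoisyFourier` (no convergence, no uniqueness clause) and is fixed-`ε` noise technology.

FREE STRUCTURE (PROVED here from landed two-rate Duhamel + dissipation, `noise_scaling`): for every `N` and
`0 < ε ≤ ε' ≤ 1`, `ε·D_N(ε) ≤ ε'·D_N(ε')` (and dually `D_N(ε')/ε' ≤ D_N(ε)/ε`): the finite-difference master
inequality `|D − D'| ≤ |ε − ε'| √(D/ε) √(D'/ε')` solves EXACTLY to `ε/ε' ≤ D'/D ≤ ε'/ε`.  This `N`-uniform
log-Lipschitz control at POSITIVE rates is what lets S1/S2 be asked only for SMALL rates: on `[ε_η, 1]` the table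
`r_N(ε) ≤ r_N(ε_η)/ε_η` is bounded once F bounds `r_N(ε_η)`.

GLUE `modulus_of_polya` (PROVED, pure real analysis): order in `ε` (S1) + pointwise closeness (S2) + a floor at
one positive rate (F) + scaling + fixed-`N` continuity ⟹ ONE modulus `w(ε) := sup_{N ≥ 2} |r_N(ε) − r_N(0)| → 0`.
Given `η`: `ε'' := min(ε_η^{S1}, ε_η^{S2})`, `N'' := max(N_η^{S1}, N₀^{S2}(ε''))`; for `N ≥ N''`, `ε ≤ ε''`:
`r_N(ε) ≤ r_N(ε'') + η ≤ r_N(0) + 2η` (S1 then S2 AT THE SINGLE RATE `ε''`) and `r_N(ε) ≥ r_N(0) − η` (closure of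
S1); the finitely many `N < N''` by fixed-`N` continuity.  No limit in `N`, no limit in `ε`, no series law, no
monotonicity in `N`, no constant uniform in `N` beyond the thresholds.

COMPOSITION `NoiseLocality_of (hS1) (hS2) (hF)`: canonical unique flip-steady families and responses
`Dc N : ℝ → ℝ` from the landed stubs (`canonical_of_three`, as in v7), `modulus_of_polya` at `r N ε := (Dc N ε)⁻¹`,
then the crux's own `μ0, με, D0, Dε` are identified with the canonical ones by uniqueness of limits along
`𝓝[≠] 0` (`N ≥ 2`, weighted form — Disproof §4 `additive_form_fails_ballistic`), and `N ≤ 1` is currentless.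

WHY THIS LINE (vs the stuck goals of v7).  v7 is stuck on M1⋆ (no comparison principle for NESS currents ACROSS
LENGTHS) and on the exact sign M2⋆ (plain form refuted at `N = 2`, weak coupling, lead c2).  Here (i) no two lengths
are ever compared; (ii) every registered stub is NECESSARY for the crux (S1, S2) or for the route (F ⊂ NoisyFourier),
so the line cannot die while the crux lives — in particular an asymptotically-localised regime where vanishing
noise ENHANCES conduction smoothly (`κ_ε ≈ κ_0 + cε`, DeRoeckHuveneers2015-type) kills M2⋆ for all large `N` but
not S1/S2; (iii) the `N`-uniform content is split by CHARACTER: S1 is an ORDER statement in the rate at fixed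
length (interpolation formula available: `∂_ε D_N ∝ 𝓔_f(U_ε^{Θ-even}) − 𝓔_f(U_ε^{Θ-odd})`; true by operator
monotonicity in the kinetic/Boltzmann–Peierls limit where the flip collision operator is positive), S2 is a
POINTWISE-in-`ε` statement whose `N → ∞` part lives at FIXED positive rate (noise technology with `ε`-dependent
constants is ALLOWED there) — see the line card for the Abel-regularised attack on S2.

Disproof used: `Cruxes/NoiseLocality/Disproof.lean` v4 — no `_false_without_` theorem, no `-- Targets` verdict;
§1 (`N ≤ 1` currentless) proved inside the composition; §3 K1 excluded by landed positivity; §4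
`pointwise_modulus_insufficient` honoured (S2 is pointwise but S1 carries the `N`-uniformity; the proved glue
outputs ONE `w`); §4 `localityShape_ballistic` consistent (all three stubs hold in the ballistic harmonic corner:
`r_N(ε) = 1/(N+1) + cε` is increasing in `ε`, `r_N(ε) − r_N(0) = cε`, `D_N(ε) → 1/(cε) > 0`); §5b: S2 is exactly the
`ε ↓ 0` lower-semicontinuity input of the road map in its weakest (eventual) form, S1 replaces equi-convergence.
-/

noncomputable section

namespace Summit.AtomisticToContinuum.FouriersLaw.Cruxes.NoiseLocality.PolyaNoiseMonotone

open Filter Topology MeasureTheory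
open Literature.MathematicalPhysics.KineticTheory.HeatConduction

/-! ## Registered stubs

Shape (D-0027 §3.3): `theorem Holds.stub_<name> : <full statement> := by sorry` (registered under `stub_<name>`
with that header text as signature) plus the by-name handle `def stub_<name> : Prop := type_of% Holds.stub_<name>`
used as hypothesis of `NoiseLocality_of`.  Statements are over tree declarations only, fully qualified. -/

/-- **Stub S1 — `stub_smallNoiseQuasiMonotone` (upward equi-quasi-monotonicity of the resistivity in the
noise; long chains, small POSITIVE rates; size L–XL; NEW; NECESSARY for the crux).**  For
`pinnedChain ω₂ lam β γ` (all `> 0`), `T > 0` and every `η > 0` there are `N_η` and `ε_η ∈ (0,1]` such that for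
every `N ≥ N_η` (`N ≥ 2`), all rates `0 < ε ≤ ε' ≤ ε_η`, THE unique weak flip-steady families `μ` (rate `ε`) and
`μ'` (rate `ε'`) at length `N` and their response coefficients `D`, `D'` at `T`: `1/D ≤ 1/D' + η` — raising a
small flip rate lowers the per-bond resistivity of a long chain by at most `η`.  Matthiessen (`r(ε) = r(0) + cε`,
exact in the pinned harmonic corner) gives it with room; it tolerates smooth noise-ENHANCED conduction
(`r` decreasing in `ε` with slope `O(1)`), unlike an exact sign.  Why it might fail: a resistivity DROP of fixed
size under arbitrarily small added noise in arbitrarily long chains — which would make `κ_ε` discontinuous at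
`0⁺` and refute the crux itself (Disproof §5b). -/
theorem Holds.stub_smallNoiseQuasiMonotone :
    ∀ ω₂ lam β γ : ℝ, 0 < ω₂ → 0 < lam → 0 < β → 0 < γ → ∀ T : ℝ, 0 < T → ∀ η : ℝ, 0 < η →
    ∃ (Nη : ℕ) (εη : ℝ), 0 < εη ∧ εη ≤ 1 ∧ ∀ (N : ℕ), Nη ≤ N → 2 ≤ N →
    ∀ ε ε' : ℝ, 0 < ε → ε ≤ ε' → ε' ≤ εη →
    ∀ μ : ℝ → ℝ →
        MeasureTheory.Measure (Literature.MathematicalPhysics.KineticTheory.HeatConduction.PhaseSpace N),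
      (∀ T_L T_R : ℝ, 0 < T_L → 0 < T_R →
        (Literature.MathematicalPhysics.KineticTheory.HeatConduction.pinnedChain ω₂ lam β γ).IsFlipSteadyState
            N T_L T_R ε (μ T_L T_R) ∧
          ∀ ν : MeasureTheory.Measure (Literature.MathematicalPhysics.KineticTheory.HeatConduction.PhaseSpace N),
            (Literature.MathematicalPhysics.KineticTheory.HeatConduction.pinnedChain ω₂ lam β γ).IsFlipSteadyState
              N T_L T_R ε ν → ν = μ T_L T_R) →
    ∀ μ' : ℝ → ℝ →
        MeasureTheory.Measure (Literature.MathematicalPhysics.KineticTheory.HeatConduction.PhaseSpace N),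
      (∀ T_L T_R : ℝ, 0 < T_L → 0 < T_R →
        (Literature.MathematicalPhysics.KineticTheory.HeatConduction.pinnedChain ω₂ lam β γ).IsFlipSteadyState
            N T_L T_R ε' (μ' T_L T_R) ∧
          ∀ ν : MeasureTheory.Measure (Literature.MathematicalPhysics.KineticTheory.HeatConduction.PhaseSpace N),
            (Literature.MathematicalPhysics.KineticTheory.HeatConduction.pinnedChain ω₂ lam β γ).IsFlipSteadyState
              N T_L T_R ε' ν → ν = μ' T_L T_R) →
    ∀ D D' : ℝ,
      Filter.Tendsto (fun δ : ℝ =>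
          (Literature.MathematicalPhysics.KineticTheory.HeatConduction.pinnedChain ω₂ lam β γ).totalCurrent
            (μ (T + δ / 2) (T - δ / 2)) / δ) (nhdsWithin 0 {(0 : ℝ)}ᶜ) (nhds D) →
      Filter.Tendsto (fun δ : ℝ =>
          (Literature.MathematicalPhysics.KineticTheory.HeatConduction.pinnedChain ω₂ lam β γ).totalCurrent
            (μ' (T + δ / 2) (T - δ / 2)) / δ) (nhdsWithin 0 {(0 : ℝ)}ᶜ) (nhds D') →
      D⁻¹ ≤ D'⁻¹ + η := by
  sorry

/-- **Stub S2 — `stub_noResidualResistivity` (no residual resistivity from vanishing noise; POINTWISE in the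
rate, EVENTUAL in the length; size XL; NEW; NECESSARY for the crux).**  For `pinnedChain ω₂ lam β γ` (all `> 0`),
`T > 0` and every `η > 0` there is `ε_η ∈ (0,1]` such that for every rate `ε ∈ (0, ε_η]` there is a threshold `N₀`
(which MAY DEPEND ON `ε`) such that for every `N ≥ N₀` (`N ≥ 2`), THE unique weak steady family `μ0` of the
deterministic chain and THE unique flip-steady family `με` at rate `ε`, both at length `N`, and their response
coefficients `D0`, `Dε` at `T`: `1/Dε ≤ 1/D0 + η` — sufficiently long chains carrying a small flip rate are at most
`η` more resistive than the noiseless chain of the same length.  With limits in hand this is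
`limsup_{ε↓0} ρ_ε ≤ ρ_0` (`liminf κ_ε ≥ κ_0`), one half of BHLLO2015's vanishing-noise continuity; the crux's
`N`-UNIFORMITY is NOT asked (the quantifiers `∀ ε ∃ N₀` are swapped relative to the crux).  Why it might fail: a
transport channel of the long deterministic chain that every positive flip rate destroys in the `N → ∞` limit
(a slow/odd quasi-conserved mode: Mazur) — then `FouriersLaw`'s finiteness fails with it (consistent kill). -/
theorem Holds.stub_noResidualResistivity :
    ∀ ω₂ lam β γ : ℝ, 0 < ω₂ → 0 < lam → 0 < β → 0 < γ → ∀ T : ℝ, 0 < T → ∀ η : ℝ, 0 < η →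
    ∃ εη : ℝ, 0 < εη ∧ εη ≤ 1 ∧ ∀ ε : ℝ, 0 < ε → ε ≤ εη → ∃ N₀ : ℕ, ∀ (N : ℕ), N₀ ≤ N → 2 ≤ N →
    ∀ μ0 : ℝ → ℝ →
        MeasureTheory.Measure (Literature.MathematicalPhysics.KineticTheory.HeatConduction.PhaseSpace N),
      (∀ T_L T_R : ℝ, 0 < T_L → 0 < T_R →
        (Literature.MathematicalPhysics.KineticTheory.HeatConduction.pinnedChain ω₂ lam β γ).IsSteadyState
            N T_L T_R (μ0 T_L T_R) ∧
          ∀ ν : MeasureTheory.Measure (Literature.MathematicalPhysics.KineticTheory.HeatConduction.PhaseSpace N),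
            (Literature.MathematicalPhysics.KineticTheory.HeatConduction.pinnedChain ω₂ lam β γ).IsSteadyState
              N T_L T_R ν → ν = μ0 T_L T_R) →
    ∀ με : ℝ → ℝ →
        MeasureTheory.Measure (Literature.MathematicalPhysics.KineticTheory.HeatConduction.PhaseSpace N),
      (∀ T_L T_R : ℝ, 0 < T_L → 0 < T_R →
        (Literature.MathematicalPhysics.KineticTheory.HeatConduction.pinnedChain ω₂ lam β γ).IsFlipSteadyState
            N T_L T_R ε (με T_L T_R) ∧
          ∀ ν : MeasureTheory.Measure (Literature.MathematicalPhysics.KineticTheory.HeatConduction.PhaseSpace N),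
            (Literature.MathematicalPhysics.KineticTheory.HeatConduction.pinnedChain ω₂ lam β γ).IsFlipSteadyState
              N T_L T_R ε ν → ν = με T_L T_R) →
    ∀ D0 Dε : ℝ,
      Filter.Tendsto (fun δ : ℝ =>
          (Literature.MathematicalPhysics.KineticTheory.HeatConduction.pinnedChain ω₂ lam β γ).totalCurrent
            (μ0 (T + δ / 2) (T - δ / 2)) / δ) (nhdsWithin 0 {(0 : ℝ)}ᶜ) (nhds D0) →
      Filter.Tendsto (fun δ : ℝ =>
          (Literature.MathematicalPhysics.KineticTheory.HeatConduction.pinnedChain ω₂ lam β γ).totalCurrent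
            (με (T + δ / 2) (T - δ / 2)) / δ) (nhdsWithin 0 {(0 : ℝ)}ᶜ) (nhds Dε) →
      Dε⁻¹ ≤ D0⁻¹ + η := by
  sorry

/-- **Stub F — `stub_noisyConductanceFloor` (eventual conductance floor of the noisy chain at each FIXED
positive rate; size L; implied by the route's crux `NoisyFourier` — `noisyFloor_of_noisyFourier` below).**  For
`pinnedChain ω₂ lam β γ` (all `> 0`), `T > 0` and every rate `ε ∈ (0,1]` there are `d > 0` and `N₀` such that for
every `N ≥ N₀`, THE unique flip-steady family `με` at rate `ε` and length `N` and its response coefficient `Dε` at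
`T`: `d ≤ Dε`.  Fixed-`ε` noise technology (flip spectral gap `∝ ε` in the momenta, entropy production, two-block
estimates; BernardinOlla2011 Props 4–8 / BernardinOlla2005 give `κ_ε ≥ c_ε > 0` in infinite volume); constants may
and will degenerate as `ε ↓ 0` — allowed here.  Why it might fail: only with `NoisyFourier` (11977) itself. -/
theorem Holds.stub_noisyConductanceFloor :
    ∀ ω₂ lam β γ : ℝ, 0 < ω₂ → 0 < lam → 0 < β → 0 < γ → ∀ T : ℝ, 0 < T →
    ∀ ε : ℝ, 0 < ε → ε ≤ 1 → ∃ d : ℝ, 0 < d ∧ ∃ N₀ : ℕ, ∀ (N : ℕ), N₀ ≤ N →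
    ∀ με : ℝ → ℝ →
        MeasureTheory.Measure (Literature.MathematicalPhysics.KineticTheory.HeatConduction.PhaseSpace N),
      (∀ T_L T_R : ℝ, 0 < T_L → 0 < T_R →
        (Literature.MathematicalPhysics.KineticTheory.HeatConduction.pinnedChain ω₂ lam β γ).IsFlipSteadyState
            N T_L T_R ε (με T_L T_R) ∧
          ∀ ν : MeasureTheory.Measure (Literature.MathematicalPhysics.KineticTheory.HeatConduction.PhaseSpace N),
            (Literature.MathematicalPhysics.KineticTheory.HeatConduction.pinnedChain ω₂ lam β γ).IsFlipSteadyState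
              N T_L T_R ε ν → ν = με T_L T_R) →
    ∀ Dε : ℝ,
      Filter.Tendsto (fun δ : ℝ =>
          (Literature.MathematicalPhysics.KineticTheory.HeatConduction.pinnedChain ω₂ lam β γ).totalCurrent
            (με (T + δ / 2) (T - δ / 2)) / δ) (nhdsWithin 0 {(0 : ℝ)}ᶜ) (nhds Dε) →
      d ≤ Dε := by
  sorry

/-- Statement of registered stub S1 (`Holds.stub_smallNoiseQuasiMonotone`), by name. -/
def stub_smallNoiseQuasiMonotone : Prop := type_of% Holds.stub_smallNoiseQuasiMonotone
/-- Statement of registered stub S2 (`Holds.stub_noResidualResistivity`), by name. -/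
def stub_noResidualResistivity : Prop := type_of% Holds.stub_noResidualResistivity
/-- Statement of registered stub F (`Holds.stub_noisyConductanceFloor`), by name. -/
def stub_noisyConductanceFloor : Prop := type_of% Holds.stub_noisyConductanceFloor

/-! ## Free structure (PROVED): the noise scaling `ε·D_N(ε)` nondecreasing, `D_N(ε)/ε` nonincreasing -/

/-- Algebra of the exact solution of the two-rate master inequality: for `0 < ε ≤ ε'`, `D, D' ≥ 0` with
`|D − D'| ≤ |ε − ε'| √(D/ε) √(D'/ε')` one has `ε D ≤ ε' D'` (substitute `D = ε s²`, `D' = ε' t²`: the hypothesis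
reads `(s + t)(ε s − ε' t) ≤ 0`). [folklore] -/
theorem scaling_of_master {ε ε' D D' : ℝ} (hε : 0 < ε) (hεε' : ε ≤ ε') (hD : 0 ≤ D) (hD' : 0 ≤ D')
    (h : |D - D'| ≤ |ε - ε'| * Real.sqrt (D / ε) * Real.sqrt (D' / ε')) : ε * D ≤ ε' * D' := by
  have hε' : 0 < ε' := hε.trans_le hεε'
  have hεne : ε ≠ 0 := hε.ne'
  have hε'ne : ε' ≠ 0 := hε'.ne'
  set s : ℝ := Real.sqrt (D / ε) with hs
  set t : ℝ := Real.sqrt (D' / ε') with ht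
  have hs0 : 0 ≤ s := Real.sqrt_nonneg _
  have ht0 : 0 ≤ t := Real.sqrt_nonneg _
  have hs2 : s ^ 2 = D / ε := Real.sq_sqrt (div_nonneg hD hε.le)
  have ht2 : t ^ 2 = D' / ε' := Real.sq_sqrt (div_nonneg hD' hε'.le)
  have hDs : D = ε * s ^ 2 := by rw [hs2]; field_simp
  have hDt : D' = ε' * t ^ 2 := by rw [ht2]; field_simp
  have habs : |ε - ε'| = ε' - ε := by
    rw [abs_sub_comm]
    exact abs_of_nonneg (by linarith)
  rw [habs] at h
  rw [hDs, hDt] at h ⊢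
  by_contra hlt
  push Not at hlt
  -- `ε' t < ε s`
  have h2 : ε' * t < ε * s := by
    by_contra hle
    push Not at hle
    have := mul_self_le_mul_self (by positivity : 0 ≤ ε * s) hle
    nlinarith
  have hs_pos : 0 < s := by
    have h' : 0 < ε * s := lt_of_le_of_lt (by positivity) h2
    exact (mul_pos_iff_of_pos_left hε).mp h'
  have h3 : 0 < s + t := by linarith
  have h4 : ε * s ^ 2 - ε' * t ^ 2 ≤ |ε * s ^ 2 - ε' * t ^ 2| := le_abs_self _
  nlinarith [mul_pos h3 (sub_pos.2 h2), h, h4]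

/-- **Noise scaling (free, fixed `N`).** For the pinned anharmonic chain (all parameters `> 0`), `T > 0`, any `N`,
rates `0 < ε ≤ ε' ≤ 1`, the unique flip-steady families at the two rates and their response coefficients:
`ε·D_N(ε) ≤ ε'·D_N(ε')`.  From the landed two-rate Duhamel bound in the flip Dirichlet form
(`helper_duhamelFlipBoundTwoRates`), the dissipation bound (`stub_flipDissipationBound`), the response densities
(`stub_responseDensityNoisy`), positivity (`stub_positiveNoisyConductance`) and `scaling_of_master`. [folklore] -/
theorem noise_scaling {ω₂ lam β γ : ℝ} (hω : 0 < ω₂) (hl : 0 < lam) (hβ : 0 < β) (hγ : 0 < γ) {T : ℝ}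
    (hT : 0 < T) (N : ℕ) {ε ε' : ℝ} (hε : 0 < ε) (hεε' : ε ≤ ε') (hε'1 : ε' ≤ 1)
    (με με' : ℝ → ℝ → Measure (PhaseSpace N))
    (hμε : ∀ T_L T_R : ℝ, 0 < T_L → 0 < T_R →
      (pinnedChain ω₂ lam β γ).IsFlipSteadyState N T_L T_R ε (με T_L T_R) ∧
        ∀ ν : Measure (PhaseSpace N), (pinnedChain ω₂ lam β γ).IsFlipSteadyState N T_L T_R ε ν → ν = με T_L T_R)
    (hμε' : ∀ T_L T_R : ℝ, 0 < T_L → 0 < T_R →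
      (pinnedChain ω₂ lam β γ).IsFlipSteadyState N T_L T_R ε' (με' T_L T_R) ∧
        ∀ ν : Measure (PhaseSpace N), (pinnedChain ω₂ lam β γ).IsFlipSteadyState N T_L T_R ε' ν → ν = με' T_L T_R)
    {Dε Dε' : ℝ}
    (hDε : Tendsto (fun δ : ℝ => (pinnedChain ω₂ lam β γ).totalCurrent (με (T + δ / 2) (T - δ / 2)) / δ)
      (𝓝[≠] 0) (𝓝 Dε))
    (hDε' : Tendsto (fun δ : ℝ => (pinnedChain ω₂ lam β γ).totalCurrent (με' (T + δ / 2) (T - δ / 2)) / δ)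
      (𝓝[≠] 0) (𝓝 Dε')) :
    ε * Dε ≤ ε' * Dε' := by
  have hε' : 0 < ε' := hε.trans_le hεε'
  rcases Nat.lt_or_ge N 2 with hN | hN
  · have hN1 : N ≤ 1 := by omega
    have h0 : Dε = 0 :=
      Summit.AtomisticToContinuum.FouriersLaw.Theorems.NoiseLocality.FeketeReduction.response_eq_zero_of_le_one
        _ hN1 με T Dε hDε
    have h0' : Dε' = 0 :=
      Summit.AtomisticToContinuum.FouriersLaw.Theorems.NoiseLocality.FeketeReduction.response_eq_zero_of_le_one
        _ hN1 με' T Dε' hDε'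
    simp [h0, h0']
  obtain ⟨Uε, hUε⟩ :=
    Summit.AtomisticToContinuum.FouriersLaw.Theorems.NoiseLocality.stub_responseDensityNoisy
      ω₂ lam β γ hω hl hβ hγ T hT N ε hε με hμε
  obtain ⟨Uε', hUε'⟩ :=
    Summit.AtomisticToContinuum.FouriersLaw.Theorems.NoiseLocality.stub_responseDensityNoisy
      ω₂ lam β γ hω hl hβ hγ T hT N ε' hε' με' hμε'
  have h1 :=
    Summit.AtomisticToContinuum.FouriersLaw.Theorems.NoiseLocality.helper_duhamelFlipBoundTwoRates
      ω₂ lam β γ hω hl hβ hγ T hT N ε ε' με με' hμε hμε' Uε Uε' hUε hUε' Dε Dε' hDε hDε'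
  have h2 :=
    Summit.AtomisticToContinuum.FouriersLaw.Theorems.NoiseLocality.stub_flipDissipationBound
      ω₂ lam β γ hω hl hβ hγ T hT N ε hε με hμε Uε hUε Dε hDε
  have h3 :=
    Summit.AtomisticToContinuum.FouriersLaw.Theorems.NoiseLocality.stub_flipDissipationBound
      ω₂ lam β γ hω hl hβ hγ T hT N ε' hε' με' hμε' Uε' hUε' Dε' hDε'
  have hn : 0 ≤ (N : ℝ) - 1 := by
    have : (2 : ℝ) ≤ N := by exact_mod_cast hN
    linarith
  have hm :=
    Summit.AtomisticToContinuum.FouriersLaw.Theorems.NoiseLocality.StubResponseContinuousInNoise.le_of_two_rate_bounds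
      hε hε' hn h1 h2 h3
  have hpos : 0 < Dε :=
    Summit.AtomisticToContinuum.FouriersLaw.Theorems.NoiseLocality.stub_positiveNoisyConductance
      ω₂ lam β γ hω hl hβ hγ N hN ε hε.le (hεε'.trans hε'1) T hT με hμε Dε hDε
  have hpos' : 0 < Dε' :=
    Summit.AtomisticToContinuum.FouriersLaw.Theorems.NoiseLocality.stub_positiveNoisyConductance
      ω₂ lam β γ hω hl hβ hγ N hN ε' hε'.le hε'1 T hT με' hμε' Dε' hDε'
  exact scaling_of_master hε hεε' hpos.le hpos'.le hm

/-! ## The edge F ⊂ NoisyFourier (PROVED) -/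

/-- **`NoisyFourier` ⟹ stub F.**  Clause (i) gives a global unique flip-steady family at rate `ε`, clause (ii) a
limit `κ_ε(T) > 0` of its responses; so the responses are eventually `≥ κ_ε(T)/2`, and any unique family at one
length has the same response (families agree at positive temperatures; uniqueness of limits). [folklore] -/
theorem noisyFloor_of_noisyFourier
    (hNF : Summit.AtomisticToContinuum.FouriersLaw.Theses.VanishingNoiseTransfer.NoisyFourier) :
    stub_noisyConductanceFloor := by
  intro ω₂ lam β γ hω hl hβ hγ T hT ε hε _hε1
  obtain ⟨hexu, κ, hκ, hconv⟩ := hNF ω₂ lam β γ hω hl hβ hγ _ rfl ε hε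
  classical
  -- a global canonical family at rate `ε` (junk outside positive temperatures)
  have hex : ∀ (N : ℕ) (T_L T_R : ℝ), ∃ μ : Measure (PhaseSpace N), (0 < T_L → 0 < T_R →
      (pinnedChain ω₂ lam β γ).IsFlipSteadyState N T_L T_R ε μ ∧
        ∀ ν : Measure (PhaseSpace N), (pinnedChain ω₂ lam β γ).IsFlipSteadyState N T_L T_R ε ν → ν = μ) := by
    intro N T_L T_R
    by_cases h : 0 < T_L ∧ 0 < T_R
    · obtain ⟨μ, hμ, hu⟩ := hexu N T_L T_R h.1 h.2
      exact ⟨μ, fun _ _ => ⟨hμ, hu⟩⟩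
    · exact ⟨0, fun hL hR => (h ⟨hL, hR⟩).elim⟩
  choose fam hfam using hex
  obtain ⟨D, hD, hDκ⟩ := hconv fam (fun N T_L T_R hL hR => (hfam N T_L T_R hL hR).1) T hT
  have hκT : 0 < κ T := hκ T hT
  have hev : ∀ᶠ N in atTop, κ T / 2 < D N := hDκ.eventually_const_lt (by linarith)
  obtain ⟨N₀, hN₀⟩ := hev.exists_forall_of_atTop
  refine ⟨κ T / 2, by positivity, N₀, fun N hN με hμε Dε hDε => ?_⟩
  have hsame : Tendsto (fun δ : ℝ => (pinnedChain ω₂ lam β γ).totalCurrent (fam N (T + δ / 2) (T - δ / 2)) / δ)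
      (𝓝[≠] 0) (𝓝 Dε) :=
    (Summit.AtomisticToContinuum.FouriersLaw.Theorems.NoiseLocality.StubResponseContinuousInNoise.tendsto_responseQuotient_iff_flip
      (pinnedChain ω₂ lam β γ) hT ε με (fam N) hμε (fun T_L T_R hL hR => (hfam N T_L T_R hL hR).1) Dε).mp hDε
  have heq : Dε = D N := tendsto_nhds_unique hsame (hD N)
  rw [heq]
  exact (hN₀ N hN).le

/-! ## The Pólya glue (PROVED, pure real analysis) -/

/-- Closure at `ε = 0⁺` of a bound on `(0, ε]`: if `f` is continuous on `[0,1]` within `[0,1]`, `0 < ε ≤ 1` and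
`f δ ≤ c` for all `δ ∈ (0, ε]`, then `f 0 ≤ c`. [folklore] -/
theorem closure_le {f : ℝ → ℝ} {ε c : ℝ} (hcont : ContinuousOn f (Set.Icc 0 1)) (hε : 0 < ε)
    (h : ∀ δ : ℝ, 0 < δ → δ ≤ ε → f δ ≤ c) : f 0 ≤ c := by
  have h0mem : (0 : ℝ) ∈ Set.Icc (0 : ℝ) 1 := ⟨le_rfl, zero_le_one⟩
  have hl : Tendsto f (𝓝[Set.Icc (0 : ℝ) 1] 0) (𝓝 (f 0)) := hcont 0 h0mem
  have hl' : Tendsto f (𝓝[>] (0 : ℝ)) (𝓝 (f 0)) := by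
    have h' := hl.mono_left (nhdsWithin_mono (0 : ℝ) (Set.Ioc_subset_Icc_self (a := (0 : ℝ)) (b := 1)))
    rwa [nhdsWithin_Ioc_eq_nhdsGT zero_lt_one] at h'
  have hev : ∀ᶠ δ in 𝓝[>] (0 : ℝ), f δ ≤ c := by
    have h1 : ∀ᶠ δ in 𝓝[>] (0 : ℝ), δ ≤ ε := mem_nhdsWithin_of_mem_nhds (Iic_mem_nhds hε)
    have h2 : ∀ᶠ δ in 𝓝[>] (0 : ℝ), 0 < δ := self_mem_nhdsWithin
    filter_upwards [h1, h2] with δ hδ1 hδ2 using h δ hδ2 hδ1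
  exact le_of_tendsto hl' hev

/-- **Pólya-type transfer.** Let `r N : ℝ → ℝ` (`N ≥ 2`) be continuous on `[0,1]` and nonnegative there, with the
scaling `r N ε' ≤ (ε'/ε) r N ε` for `0 < ε ≤ ε' ≤ 1`.  Suppose (S1) for every `η > 0` there are `N_η`, `ε_η ∈ (0,1]`
with `r N ε ≤ r N ε' + η` for `N ≥ N_η`, `0 < ε ≤ ε' ≤ ε_η`; (S2) for every `η > 0` there is `ε_η ∈ (0,1]` such that
for every `ε ∈ (0, ε_η]` eventually in `N`, `r N ε ≤ r N 0 + η`; (F) for every `ε ∈ (0,1]`, `r N ε` is eventually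
(in `N`) bounded.  Then there is ONE modulus `w → 0` at `0⁺` with `|r N ε − r N 0| ≤ w ε` for ALL `N ≥ 2`,
`ε ∈ (0,1]`. [folklore] -/
theorem modulus_of_polya (r : ℕ → ℝ → ℝ)
    (hcont : ∀ N : ℕ, 2 ≤ N → ContinuousOn (r N) (Set.Icc 0 1))
    (hpos : ∀ N : ℕ, 2 ≤ N → ∀ ε : ℝ, 0 ≤ ε → ε ≤ 1 → 0 ≤ r N ε)
    (hscale : ∀ N : ℕ, 2 ≤ N → ∀ ε ε' : ℝ, 0 < ε → ε ≤ ε' → ε' ≤ 1 → r N ε' ≤ ε' / ε * r N ε)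
    (hmono : ∀ η : ℝ, 0 < η → ∃ (Nη : ℕ) (εη : ℝ), 0 < εη ∧ εη ≤ 1 ∧
      ∀ N : ℕ, Nη ≤ N → 2 ≤ N → ∀ ε ε' : ℝ, 0 < ε → ε ≤ ε' → ε' ≤ εη → r N ε ≤ r N ε' + η)
    (hlim : ∀ η : ℝ, 0 < η → ∃ εη : ℝ, 0 < εη ∧ εη ≤ 1 ∧
      ∀ ε : ℝ, 0 < ε → ε ≤ εη → ∃ N₀ : ℕ, ∀ N : ℕ, N₀ ≤ N → 2 ≤ N → r N ε ≤ r N 0 + η)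
    (hfloor : ∀ ε : ℝ, 0 < ε → ε ≤ 1 → ∃ (B : ℝ) (N₀ : ℕ), ∀ N : ℕ, N₀ ≤ N → 2 ≤ N → r N ε ≤ B) :
    ∃ w : ℝ → ℝ, Tendsto w (𝓝[>] 0) (𝓝 0) ∧
      ∀ N : ℕ, 2 ≤ N → ∀ ε : ℝ, 0 < ε → ε ≤ 1 → |r N ε - r N 0| ≤ w ε := by
  -- closure of (S1) at `ε = 0⁺`: the lower half
  have hmono0 : ∀ η : ℝ, 0 < η → ∃ (Nη : ℕ) (εη : ℝ), 0 < εη ∧ εη ≤ 1 ∧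
      ∀ N : ℕ, Nη ≤ N → 2 ≤ N → ∀ ε : ℝ, 0 < ε → ε ≤ εη → r N 0 ≤ r N ε + η := by
    intro η hη
    obtain ⟨Nη, εη, hεη, hεη1, h⟩ := hmono η hη
    refine ⟨Nη, εη, hεη, hεη1, fun N hN hN2 ε hε hεη' => ?_⟩
    exact closure_le (hcont N hN2) hε fun δ hδ hδε => h N hN hN2 δ ε hδ hδε hεη'
  -- Step A: a uniform bound on the tail
  obtain ⟨N₁, ε₁, hε₁, hε₁1, h1⟩ := hmono 1 one_pos
  obtain ⟨N₁', ε₁', hε₁', hε₁'1, h1'⟩ := hmono0 1 one_pos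
  set e : ℝ := min ε₁ ε₁' with he
  have he0 : 0 < e := lt_min hε₁ hε₁'
  have he1 : e ≤ 1 := (min_le_left _ _).trans hε₁1
  obtain ⟨B, N₂, hB⟩ := hfloor e he0 he1
  set M : ℕ := max (max (max N₁ N₁') N₂) 2 with hM
  have hM2 : 2 ≤ M := le_max_right _ _
  have hMN₁ : N₁ ≤ M := ((le_max_left _ _).trans (le_max_left _ _)).trans (le_max_left _ _)
  have hMN₁' : N₁' ≤ M := ((le_max_right _ _).trans (le_max_left _ _)).trans (le_max_left _ _)
  have hMN₂ : N₂ ≤ M := (le_max_right _ _).trans (le_max_left _ _)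
  have hBe : ∀ N : ℕ, M ≤ N → r N e ≤ B := fun N hN => hB N (hMN₂.trans hN) (hM2.trans hN)
  have hB0 : 0 ≤ B := (hpos M hM2 e he0.le he1).trans (hBe M le_rfl)
  set K : ℝ := max (B + 1) (B / e) with hK
  have tail : ∀ N : ℕ, M ≤ N → ∀ ε : ℝ, 0 ≤ ε → ε ≤ 1 → r N ε ≤ K := by
    intro N hN ε hε0 hε1
    have hN2 : 2 ≤ N := hM2.trans hN
    rcases hε0.eq_or_lt with h | h
    · -- `ε = 0`
      subst h
      have := h1' N (hMN₁'.trans hN) hN2 e he0 (min_le_right _ _)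
      calc r N 0 ≤ r N e + 1 := this
        _ ≤ B + 1 := by linarith [hBe N hN]
        _ ≤ K := le_max_left _ _
    · rcases le_or_gt ε e with h' | h'
      · have := h1 N (hMN₁.trans hN) hN2 ε e h h' (min_le_left _ _)
        calc r N ε ≤ r N e + 1 := this
          _ ≤ B + 1 := by linarith [hBe N hN]
          _ ≤ K := le_max_left _ _
      · have hs := hscale N hN2 e ε he0 h'.le hε1
        calc r N ε ≤ ε / e * r N e := hs
          _ ≤ 1 / e * B := by
              apply mul_le_mul _ (hBe N hN) (hpos N hN2 e he0.le he1) (by positivity)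
              exact div_le_div_of_nonneg_right hε1 he0.le
          _ = B / e := by ring
          _ ≤ K := le_max_right _ _
  have hK0 : 0 ≤ K := (hpos M hM2 0 le_rfl zero_le_one).trans (tail M le_rfl 0 le_rfl zero_le_one)
  -- the discrepancy table, indexed from `N = 2`
  set g : ℝ → ℕ → ℝ := fun ε n => |r (n + 2) ε - r (n + 2) 0| with hg
  have g_nonneg : ∀ ε n, 0 ≤ g ε n := fun ε n => abs_nonneg _
  have g_tail_le : ∀ ε : ℝ, 0 < ε → ε ≤ 1 → ∀ n, M ≤ n + 2 → g ε n ≤ K := by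
    intro ε hε hε1 n hn
    have a := tail (n + 2) hn ε hε.le hε1
    have b := tail (n + 2) hn 0 le_rfl zero_le_one
    have c := hpos (n + 2) (by omega) ε hε.le hε1
    have d := hpos (n + 2) (by omega) 0 le_rfl zero_le_one
    simp only [hg]
    rw [abs_le]
    constructor <;> linarith
  have hbdd : ∀ ε : ℝ, 0 < ε → ε ≤ 1 → BddAbove (Set.range (g ε)) := by
    intro ε hε hε1
    have hfin : BddAbove ((g ε) '' Set.Iio M) := ((Set.finite_Iio M).image _).bddAbove
    have htail : BddAbove ((g ε) '' Set.Ici M) :=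
      ⟨K, by
        rintro _ ⟨n, hn, rfl⟩
        exact g_tail_le ε hε hε1 n (le_trans hn (Nat.le_add_right n 2))⟩
    refine (hfin.union htail).mono ?_
    rintro _ ⟨n, rfl⟩
    rcases lt_or_ge n M with hn | hn
    · exact Or.inl ⟨n, hn, rfl⟩
    · exact Or.inr ⟨n, hn, rfl⟩
  refine ⟨fun ε => ⨆ n, g ε n, ?_, ?_⟩
  · -- Step B: the modulus tends to `0`
    refine Metric.tendsto_nhds.mpr fun η hη => ?_
    have hη4 : 0 < η / 4 := by positivity
    obtain ⟨Na, εa, hεa, hεa1, ha⟩ := hmono (η / 4) hη4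
    obtain ⟨Na', εa', hεa', hεa'1, ha'⟩ := hmono0 (η / 4) hη4
    obtain ⟨εb, hεb, hεb1, hb⟩ := hlim (η / 4) hη4
    set e'' : ℝ := min (min εa εa') εb with he''
    have he''0 : 0 < e'' := lt_min (lt_min hεa hεa') hεb
    have he''a : e'' ≤ εa := (min_le_left _ _).trans (min_le_left _ _)
    have he''a' : e'' ≤ εa' := (min_le_left _ _).trans (min_le_right _ _)
    have he''b : e'' ≤ εb := min_le_right _ _
    obtain ⟨Nb, hNb⟩ := hb e'' he''0 he''b
    set N'' : ℕ := max (max Na Na') Nb with hN''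
    -- the tail `n + 2 ≥ N''`, for `ε ≤ e''`
    have htail : ∀ ε : ℝ, 0 < ε → ε ≤ e'' → ∀ n : ℕ, N'' ≤ n + 2 → g ε n ≤ η / 2 := by
      intro ε hε hεe n hn
      have hn2 : 2 ≤ n + 2 := by omega
      have hNa : Na ≤ n + 2 := ((le_max_left _ _).trans (le_max_left _ _)).trans hn
      have hNa' : Na' ≤ n + 2 := ((le_max_right _ _).trans (le_max_left _ _)).trans hn
      have hNb' : Nb ≤ n + 2 := (le_max_right _ _).trans hn
      have up1 : r (n + 2) ε ≤ r (n + 2) e'' + η / 4 := ha (n + 2) hNa hn2 ε e'' hε hεe he''a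
      have up2 : r (n + 2) e'' ≤ r (n + 2) 0 + η / 4 := hNb (n + 2) hNb' hn2
      have lo : r (n + 2) 0 ≤ r (n + 2) ε + η / 4 := ha' (n + 2) hNa' hn2 ε hε (hεe.trans he''a')
      simp only [hg]
      rw [abs_le]
      constructor <;> linarith
    -- the finitely many `n + 2 < N''`: fixed-`N` continuity at `0`
    have hfin : ∀ᶠ ε in 𝓝[>] (0 : ℝ), ∀ n ∈ Finset.range N'', g ε n < η / 2 := by
      refine (eventually_all_finset _).mpr fun n _ => ?_
      have h0mem : (0 : ℝ) ∈ Set.Icc (0 : ℝ) 1 := ⟨le_rfl, zero_le_one⟩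
      have hr : Tendsto (r (n + 2)) (𝓝[>] (0 : ℝ)) (𝓝 (r (n + 2) 0)) := by
        have h' := (hcont (n + 2) (by omega) 0 h0mem).mono_left
          (nhdsWithin_mono (0 : ℝ) (Set.Ioc_subset_Icc_self (a := (0 : ℝ)) (b := 1)))
        rwa [nhdsWithin_Ioc_eq_nhdsGT zero_lt_one] at h'
      have h0 : Tendsto (fun ε => g ε n) (𝓝[>] 0) (𝓝 0) := by
        have := (hr.sub_const (r (n + 2) 0)).abs
        simpa [hg] using this
      have := (Metric.tendsto_nhds.mp h0) (η / 2) (by positivity)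
      simpa only [Real.dist_eq, sub_zero, abs_of_nonneg (g_nonneg _ n)] using this
    have h2ev : ∀ᶠ ε in 𝓝[>] (0 : ℝ), ε ≤ 1 := mem_nhdsWithin_of_mem_nhds (Iic_mem_nhds one_pos)
    have h3ev : ∀ᶠ ε in 𝓝[>] (0 : ℝ), 0 < ε := self_mem_nhdsWithin
    have h4ev : ∀ᶠ ε in 𝓝[>] (0 : ℝ), ε ≤ e'' := mem_nhdsWithin_of_mem_nhds (Iic_mem_nhds he''0)
    filter_upwards [hfin, h2ev, h3ev, h4ev] with ε hfε hε1 hε hεe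
    have hall : ∀ n, g ε n ≤ η / 2 := by
      intro n
      rcases lt_or_ge (n + 2) N'' with hn | hn
      · exact (hfε n (Finset.mem_range.mpr (by omega))).le
      · exact htail ε hε hεe n hn
    have hsup : (⨆ n, g ε n) ≤ η / 2 := ciSup_le hall
    have hsup0 : 0 ≤ ⨆ n, g ε n := le_ciSup_of_le (hbdd ε hε hε1) 0 (g_nonneg ε 0)
    rw [Real.dist_eq, sub_zero, abs_of_nonneg hsup0]
    linarith
  · -- the bound itself
    intro N hN ε hε hε1
    obtain ⟨n, rfl⟩ : ∃ n, N = n + 2 := ⟨N - 2, by omega⟩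
    exact le_ciSup (hbdd ε hε hε1) n

/-! ## Canonical families and responses from the LANDED stubs 1–3 (proved; as in v7) -/

/-- Landed stubs 1–3 ⇒ canonical unique flip-steady families `μc N ε` (`ε ∈ [0,1]`) and canonical responses
`Dc N : ℝ → ℝ`, continuous on `[0,1]`, positive for `N ≥ 2`, and equal to the response of EVERY unique flip-steady
family at rate `ε`. [folklore] -/
theorem canonical_of_three {ω₂ lam β γ : ℝ} (hω : 0 < ω₂) (hl : 0 < lam) (hβ : 0 < β) (hγ : 0 < γ) {T : ℝ}
    (hT : 0 < T) :
    ∃ (μc : (N : ℕ) → ℝ → ℝ → ℝ → Measure (PhaseSpace N)) (Dc : ℕ → ℝ → ℝ),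
      (∀ (N : ℕ) (ε : ℝ), 0 ≤ ε → ε ≤ 1 → ∀ T_L T_R : ℝ, 0 < T_L → 0 < T_R →
        (pinnedChain ω₂ lam β γ).IsFlipSteadyState N T_L T_R ε (μc N ε T_L T_R) ∧
          ∀ ν : Measure (PhaseSpace N),
            (pinnedChain ω₂ lam β γ).IsFlipSteadyState N T_L T_R ε ν → ν = μc N ε T_L T_R) ∧
      (∀ N : ℕ, ContinuousOn (Dc N) (Set.Icc 0 1)) ∧
      (∀ N : ℕ, 2 ≤ N → ∀ ε : ℝ, 0 ≤ ε → ε ≤ 1 → 0 < Dc N ε) ∧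
      (∀ (N : ℕ) (ε : ℝ), 0 ≤ ε → ε ≤ 1 →
        ∀ μ : ℝ → ℝ → Measure (PhaseSpace N),
          (∀ T_L T_R : ℝ, 0 < T_L → 0 < T_R →
            (pinnedChain ω₂ lam β γ).IsFlipSteadyState N T_L T_R ε (μ T_L T_R) ∧
              ∀ ν : Measure (PhaseSpace N),
                (pinnedChain ω₂ lam β γ).IsFlipSteadyState N T_L T_R ε ν → ν = μ T_L T_R) →
          Tendsto (fun δ : ℝ =>
            (pinnedChain ω₂ lam β γ).totalCurrent (μ (T + δ / 2) (T - δ / 2)) / δ) (𝓝[≠] 0)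
            (𝓝 (Dc N ε))) := by
  have hex : ∀ (N : ℕ) (ε T_L T_R : ℝ), ∃ μ : Measure (PhaseSpace N),
      (0 ≤ ε → ε ≤ 1 → 0 < T_L → 0 < T_R →
        (pinnedChain ω₂ lam β γ).IsFlipSteadyState N T_L T_R ε μ ∧
          ∀ ν : Measure (PhaseSpace N),
            (pinnedChain ω₂ lam β γ).IsFlipSteadyState N T_L T_R ε ν → ν = μ) := by
    intro N ε T_L T_R
    by_cases h : 0 ≤ ε ∧ ε ≤ 1 ∧ 0 < T_L ∧ 0 < T_R
    · obtain ⟨μ, hμ⟩ :=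
        Summit.AtomisticToContinuum.FouriersLaw.Theorems.NoiseLocality.stub_flipSteadyStateWellPosed
          ω₂ lam β γ hω hl hβ hγ N ε h.1 h.2.1 T_L T_R h.2.2.1 h.2.2.2
      exact ⟨μ, fun _ _ _ _ => hμ⟩
    · exact ⟨0, fun h0 h1' hL hR => (h ⟨h0, h1', hL, hR⟩).elim⟩
  choose μc hμc using hex
  have hfam : ∀ (N : ℕ) (ε : ℝ), 0 ≤ ε → ε ≤ 1 → ∀ T_L T_R : ℝ, 0 < T_L → 0 < T_R →
      (pinnedChain ω₂ lam β γ).IsFlipSteadyState N T_L T_R ε (μc N ε T_L T_R) ∧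
        ∀ ν : Measure (PhaseSpace N),
          (pinnedChain ω₂ lam β γ).IsFlipSteadyState N T_L T_R ε ν → ν = μc N ε T_L T_R :=
    fun N ε h0 h1' T_L T_R hL hR => hμc N ε T_L T_R h0 h1' hL hR
  choose Dc hDc_cont hDc using fun N : ℕ =>
    Summit.AtomisticToContinuum.FouriersLaw.Theorems.NoiseLocality.stub_responseContinuousInNoise
      ω₂ lam β γ hω hl hβ hγ N T hT
  have hDc_can : ∀ (N : ℕ) (ε : ℝ), 0 ≤ ε → ε ≤ 1 →
      Tendsto (fun δ : ℝ => (pinnedChain ω₂ lam β γ).totalCurrent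
        (μc N ε (T + δ / 2) (T - δ / 2)) / δ) (𝓝[≠] 0) (𝓝 (Dc N ε)) :=
    fun N ε h0 h1' => hDc N ε h0 h1' (μc N ε) (hfam N ε h0 h1')
  have hposc : ∀ N : ℕ, 2 ≤ N → ∀ ε : ℝ, 0 ≤ ε → ε ≤ 1 → 0 < Dc N ε :=
    fun N hN ε h0 h1' =>
      Summit.AtomisticToContinuum.FouriersLaw.Theorems.NoiseLocality.stub_positiveNoisyConductance
        ω₂ lam β γ hω hl hβ hγ N hN ε h0 h1' T hT (μc N ε) (hfam N ε h0 h1') (Dc N ε) (hDc_can N ε h0 h1')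
  exact ⟨μc, Dc, hfam, hDc_cont, hposc, hDc⟩

/-! ## Composition (sorry-free apart from the three registered stubs): S1 ∧ S2 ∧ F ⟹ the crux BY NAME -/

/-- **`NoiseLocality_of`** — the skeleton's deciding theorem: `stub_smallNoiseQuasiMonotone` (S1),
`stub_noResidualResistivity` (S2) and `stub_noisyConductanceFloor` (F) imply `VanishingNoiseTransfer.NoiseLocality`.
`canonical_of_three` gives the canonical responses; S1/S2/F and `noise_scaling` instantiated at the canonical
families give the hypotheses of `modulus_of_polya` for `r N ε := (Dc N ε)⁻¹`; the crux's own `μ0, με, D0, Dε`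
are identified with the canonical ones by uniqueness of limits along `𝓝[≠] 0` (`N ≥ 2`), and `N ≤ 1` is
currentless. [folklore] -/
theorem NoiseLocality_of (hS1 : stub_smallNoiseQuasiMonotone) (hS2 : stub_noResidualResistivity)
    (hF : stub_noisyConductanceFloor) :
    Summit.AtomisticToContinuum.FouriersLaw.Theses.VanishingNoiseTransfer.NoiseLocality := by
  intro ω₂ lam β γ hω hl hβ hγ S hS T hT
  subst hS
  obtain ⟨μc, Dc, hfam, hcont, hpos, hcan⟩ := canonical_of_three hω hl hβ hγ hT
  -- the deterministic canonical family in `IsSteadyState` form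
  have hfam0 : ∀ (N : ℕ) (T_L T_R : ℝ), 0 < T_L → 0 < T_R →
      (pinnedChain ω₂ lam β γ).IsSteadyState N T_L T_R (μc N 0 T_L T_R) ∧
        ∀ ν : Measure (PhaseSpace N),
          (pinnedChain ω₂ lam β γ).IsSteadyState N T_L T_R ν → ν = μc N 0 T_L T_R := by
    intro N T_L T_R hL hR
    obtain ⟨h1, h2⟩ := hfam N 0 le_rfl zero_le_one T_L T_R hL hR
    refine ⟨((pinnedChain ω₂ lam β γ).isFlipSteadyState_zero_iff N T_L T_R _).1 h1, fun ν hν => h2 ν ?_⟩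
    exact ((pinnedChain ω₂ lam β γ).isFlipSteadyState_zero_iff N T_L T_R ν).2 hν
  -- the table of resistivities
  set r : ℕ → ℝ → ℝ := fun N ε => (Dc N ε)⁻¹ with hr
  have hcont' : ∀ N : ℕ, 2 ≤ N → ContinuousOn (r N) (Set.Icc 0 1) :=
    fun N hN => (hcont N).inv₀ fun ε hε => (hpos N hN ε hε.1 hε.2).ne'
  have hpos' : ∀ N : ℕ, 2 ≤ N → ∀ ε : ℝ, 0 ≤ ε → ε ≤ 1 → 0 ≤ r N ε := fun N hN ε hε0 hε1 => by
    simp only [hr]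
    exact (inv_pos.2 (hpos N hN ε hε0 hε1)).le
  -- scaling (free)
  have hscale : ∀ N : ℕ, 2 ≤ N → ∀ ε ε' : ℝ, 0 < ε → ε ≤ ε' → ε' ≤ 1 → r N ε' ≤ ε' / ε * r N ε := by
    intro N hN ε ε' hε hεε' hε'1
    have hε' : 0 < ε' := hε.trans_le hεε'
    have h := noise_scaling hω hl hβ hγ hT N hε hεε' hε'1 (μc N ε) (μc N ε') (hfam N ε hε.le (hεε'.trans hε'1))
      (hfam N ε' hε'.le hε'1) (hcan N ε hε.le (hεε'.trans hε'1) (μc N ε) (hfam N ε hε.le (hεε'.trans hε'1)))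
      (hcan N ε' hε'.le hε'1 (μc N ε') (hfam N ε' hε'.le hε'1))
    have hD : 0 < Dc N ε := hpos N hN ε hε.le (hεε'.trans hε'1)
    have hD' : 0 < Dc N ε' := hpos N hN ε' hε'.le hε'1
    have hεne : ε ≠ 0 := hε.ne'
    have hε'ne : ε' ≠ 0 := hε'.ne'
    have hDne : Dc N ε ≠ 0 := hD.ne'
    have h' : ε / ε' * Dc N ε ≤ Dc N ε' := by
      rw [div_mul_eq_mul_div, div_le_iff₀ hε']
      calc ε * Dc N ε ≤ ε' * Dc N ε' := h
        _ = Dc N ε' * ε' := mul_comm _ _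
    have hpos'' : 0 < ε / ε' * Dc N ε := by positivity
    simp only [hr]
    calc (Dc N ε')⁻¹ ≤ (ε / ε' * Dc N ε)⁻¹ := inv_anti₀ hpos'' h'
      _ = ε' / ε * (Dc N ε)⁻¹ := by field_simp
  -- S1 at the canonical families
  have hmono : ∀ η : ℝ, 0 < η → ∃ (Nη : ℕ) (εη : ℝ), 0 < εη ∧ εη ≤ 1 ∧
      ∀ N : ℕ, Nη ≤ N → 2 ≤ N → ∀ ε ε' : ℝ, 0 < ε → ε ≤ ε' → ε' ≤ εη → r N ε ≤ r N ε' + η := by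
    intro η hη
    obtain ⟨Nη, εη, hεη, hεη1, h⟩ := hS1 ω₂ lam β γ hω hl hβ hγ T hT η hη
    refine ⟨Nη, εη, hεη, hεη1, fun N hN hN2 ε ε' hε hεε' hε'η => ?_⟩
    have hε' : 0 < ε' := hε.trans_le hεε'
    have hε1 : ε ≤ 1 := hεε'.trans (hε'η.trans hεη1)
    have hε'1 : ε' ≤ 1 := hε'η.trans hεη1
    have := h N hN hN2 ε ε' hε hεε' hε'η (μc N ε) (hfam N ε hε.le hε1) (μc N ε') (hfam N ε' hε'.le hε'1)
      (Dc N ε) (Dc N ε') (hcan N ε hε.le hε1 (μc N ε) (hfam N ε hε.le hε1))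
      (hcan N ε' hε'.le hε'1 (μc N ε') (hfam N ε' hε'.le hε'1))
    simpa only [hr] using this
  -- S2 at the canonical families
  have hlim : ∀ η : ℝ, 0 < η → ∃ εη : ℝ, 0 < εη ∧ εη ≤ 1 ∧
      ∀ ε : ℝ, 0 < ε → ε ≤ εη → ∃ N₀ : ℕ, ∀ N : ℕ, N₀ ≤ N → 2 ≤ N → r N ε ≤ r N 0 + η := by
    intro η hη
    obtain ⟨εη, hεη, hεη1, h⟩ := hS2 ω₂ lam β γ hω hl hβ hγ T hT η hη
    refine ⟨εη, hεη, hεη1, fun ε hε hεη' => ?_⟩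
    obtain ⟨N₀, hN₀⟩ := h ε hε hεη'
    refine ⟨N₀, fun N hN hN2 => ?_⟩
    have hε1 : ε ≤ 1 := hεη'.trans hεη1
    have := hN₀ N hN hN2 (μc N 0) (hfam0 N) (μc N ε) (hfam N ε hε.le hε1) (Dc N 0) (Dc N ε)
      (hcan N 0 le_rfl zero_le_one (μc N 0) (hfam N 0 le_rfl zero_le_one))
      (hcan N ε hε.le hε1 (μc N ε) (hfam N ε hε.le hε1))
    simpa only [hr] using this
  -- F at the canonical families
  have hfloor : ∀ ε : ℝ, 0 < ε → ε ≤ 1 → ∃ (B : ℝ) (N₀ : ℕ), ∀ N : ℕ, N₀ ≤ N → 2 ≤ N → r N ε ≤ B := by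
    intro ε hε hε1
    obtain ⟨d, hd, N₀, h⟩ := hF ω₂ lam β γ hω hl hβ hγ T hT ε hε hε1
    refine ⟨d⁻¹, N₀, fun N hN hN2 => ?_⟩
    have := h N hN (μc N ε) (hfam N ε hε.le hε1) (Dc N ε) (hcan N ε hε.le hε1 (μc N ε) (hfam N ε hε.le hε1))
    simp only [hr]
    exact inv_anti₀ hd this
  obtain ⟨w, hw, hwb⟩ := modulus_of_polya r hcont' hpos' hscale hmono hlim hfloor
  -- the crux for its own `μ0, με, D0, Dε`
  refine ⟨w, hw, ?_⟩
  intro N ε hε hε1 μ0 με hμ0 hμε D0 Dε hD0 hDε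
  by_cases hN : 2 ≤ N
  · have hμ0' : ∀ T_L T_R : ℝ, 0 < T_L → 0 < T_R →
        (pinnedChain ω₂ lam β γ).IsFlipSteadyState N T_L T_R 0 (μ0 T_L T_R) ∧
          ∀ ν : Measure (PhaseSpace N),
            (pinnedChain ω₂ lam β γ).IsFlipSteadyState N T_L T_R 0 ν → ν = μ0 T_L T_R := by
      intro T_L T_R hL hR
      refine ⟨((pinnedChain ω₂ lam β γ).isFlipSteadyState_zero_iff N T_L T_R _).2 (hμ0 T_L T_R hL hR).1,
        fun ν hν => (hμ0 T_L T_R hL hR).2 ν ?_⟩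
      exact ((pinnedChain ω₂ lam β γ).isFlipSteadyState_zero_iff N T_L T_R ν).1 hν
    have hD0eq : D0 = Dc N 0 := tendsto_nhds_unique hD0 (hcan N 0 le_rfl zero_le_one μ0 hμ0')
    have hDεeq : Dε = Dc N ε := tendsto_nhds_unique hDε (hcan N ε hε.le hε1 με hμε)
    have hD0pos : 0 < D0 := hD0eq ▸ hpos N hN 0 le_rfl zero_le_one
    have hDεpos : 0 < Dε := hDεeq ▸ hpos N hN ε hε.le hε1
    have hb : |Dε⁻¹ - D0⁻¹| ≤ w ε := by
      rw [hD0eq, hDεeq]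
      exact hwb N hN ε hε hε1
    have key : D0 - Dε = D0 * Dε * (Dε⁻¹ - D0⁻¹) := by
      rw [mul_sub, mul_assoc, mul_inv_cancel₀ hDεpos.ne', mul_one, mul_comm D0 Dε, mul_assoc,
        mul_inv_cancel₀ hD0pos.ne', mul_one]
    rw [key, abs_mul, abs_mul]
    calc |D0| * |Dε| * |Dε⁻¹ - D0⁻¹| ≤ |D0| * |Dε| * w ε := by gcongr
      _ = w ε * |D0| * |Dε| := by ring
  · -- `N ≤ 1`: no bond, no current, `D0 = Dε = 0`
    have hN1 : N ≤ 1 := by omega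
    have h0 : D0 = 0 :=
      Summit.AtomisticToContinuum.FouriersLaw.Theorems.NoiseLocality.FeketeReduction.response_eq_zero_of_le_one _ hN1 μ0 T D0 hD0
    have hε0 : Dε = 0 :=
      Summit.AtomisticToContinuum.FouriersLaw.Theorems.NoiseLocality.FeketeReduction.response_eq_zero_of_le_one _ hN1 με T Dε hDε
    simp [h0, hε0]

end Summit.AtomisticToContinuum.FouriersLaw.Cruxes.NoiseLocality.PolyaNoiseMonotone

end
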